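/-
COR-CM (cells pub-hodgecm / pub-hodgecm2, stage 2 of the Hodge ladder) — TRANSPOSITION item (vi), the X3-ω PINS `σ ∕ hσ ∕ e ∕ he` of the Δ2
bridge at the line of record (pin-3 `Item6PlacementJunctionAppendixCAtCharacter`, index-free keys, own-htheta's design word HOME l.10534),
DISCHARGED for the Liu datum `R := Model.restOfCharRep … δ′ r μ hμ hw` (`Transposition/Item6RestOfCharRep.lean`) AT A REPRESENTED COLLECTION:
for a collection `ε` whose representative `r ε` carries the package's line of record (`JW (r ε) = JW′`, `TW (r ε) = TW′`) and an
ε-normaliser `δ′` ANTI-ORIENTED to `δ_F` (`Im τ(δ′)·Im τ(δ_F) < 0`), every character `χ` of the line's unitary group with open kernel and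
trivial rational restriction (= the package's `IsAutChar`, unfolded) gives
* `σ`: the ADMISSIBLE index `(ε, χ ∘ centre)` of `toThm418Data (sec42DataOf …) R` — [Liu2021] Def. 4.12 with the admissible element
  `e₀ := (r ε)·δ′`, `epsOf_{δ′} e₀ = ε` (`Def411WeilCarriers.epsOf_algebraMap_mul` + faithfulness of `r`); injective in `χ` (`hσ`);
* `e`: the `ℂ`-linear identification of the package's Weil `χ`-coinvariant module at `(TW′, JW′, ι_{toHecke μ})` (port file
  `HodgeCM/Model/WeilCentralCoinvariants_2`, the carrier of `SplitLine.Ω`) with `ω(μ, ε, χ ∘ centre) = (toThm418Data … R).omegaAt σ`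
  — the two relation submodules of `𝒮((𝔸_{F⁺}^∞)³)` COINCIDE (`Submodule.quotEquivOfEq`);
* `he`: its `𝔾(𝔸^∞)`-equivariance (`weilCoinv_mk` on both sides).
PART 2 of item6-p3 g13's `Item6OmegaTransportAtLine.v1.lean` (md5 d300c6f73c1e, 588 l.; author prover-pub-hodgecm2-item6-p3-g13-0), SPLIT for
the 400-line house rule by the Δ2-bridge PEN prover-pub-hodgecm2-d2bridge-prove-4-g1-0 with every declaration BYTE-IDENTICAL to the author's;
PART 1 = `Transposition/Item6OmegaTransportCenter.lean` (§1 `centerToLine ∕ chiAtLine`, §2 `isAdmissibleElement_mul_of_antiOriented`, §5 kit).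
Definitions (`admIndexAtLine`, `omegaTransportAtLine`) + theorems; no named fact, no instance, no `variable`; nothing landed is edited or
restated; the package modules are IMPORTED, not restated.  HC_CM is NOT proved; «Δ2 BRIDGE CLOSED» is NOT claimed; which `δ′` is [Liu2021]
AS PRINTED is the consumer's displayed convention (referee object-match (c): `(2δ_F)⁻¹` — and NOT `δ̄_F`, which is off by the class of `2` —
instantiated in `CorCM/D2Bridge/OmegaAtDeltaPrime.lean`), not decided here; no pointer moves.
-/
import Summits.HodgeConjecture.CorCM.B01.Transposition.Item6RestOfCharRep
import Summits.HodgeConjecture.CorCM.B01.Transposition.Item6OmegaTransportCenter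
import Summits.HodgeConjecture.HodgeCM.Model.WeilCentralCoinvariants_2
import HarnessLib

set_option autoImplicit false

/-!
# X3-ω at the line of record: `σ ∕ hσ ∕ e ∕ he` for `restOfCharRep … δ′ r μ hμ hw`

KEYS (all explicit; the pin-3 keys `(V a₀ a μ hμ hw hΦ hι₁ χa)` instantiate them with `F := ⟨L.K⟩`, `V := ⟨V.Hm, …⟩`, `e := e₁`,
`dV := frameD V`, `ιV := ιVE V`, `ε := locF u_a`, `r := Rep.update Rep.ofLineOf (locF u_a) u_a rfl` (so `r ε = u_a`, `Rep.update_toFun_self`),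
`TW′ := realDiagonal L (vec a) _`, `JW′ := diagonal (vec a)`, `hΦ` from `HasCMType μ Φ^δ(a)` by `IsConjugateSymplectic.cmType_eq` +
`SignRecipe.mem_lineType_iff` (`η_L = δ_L`), `χ := χa.1` with `isAutChar_iff`):
* §3 `admIndexAtLine` (= `σ`), `admIndexAtLine_injective` (= `hσ`), `admIndexAtLine_fst`;
* §4 `omegaTransportAtLine` (= `e`), `omegaTransportAtLine_mk`, `omegaTransportAtLine_smul` (= `he`).

HC_CM is NOT proved.
-/

noncomputable section

open scoped TensorProduct Matrix

namespace Summit.HodgeConjecture.CorCM.Model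

open CategoryTheory CategoryTheory.Limits AlgebraicGeometry NumberField IsDedekindDomain
open Literature.AlgebraicGeometry.Motives
open Literature.AlgebraicGeometry.HodgeTheory
open Literature.AlgebraicGeometry.ShimuraVarieties
open Literature.AlgebraicGeometry.ShimuraVarieties.UnitaryCanonicalModel
open Literature.AlgebraicGeometry.Liu2021 (IsAdmissibleElement)
open Literature.NumberTheory.ComplexMultiplication
open Literature.NumberTheory.Automorphic
open Literature.NumberTheory.Automorphic.IdeleClassGroup
open Literature.NumberTheory.Automorphic.PicardCM
open Literature.NumberTheory.Automorphic.Liu2021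
open Literature.NumberTheory.Automorphic.Liu2021.AppendixC
open Literature.NumberTheory.Automorphic.Liu2021.AppendixC.RestOne
open Literature.NumberTheory.Automorphic.Liu2021.Def411WeilCarriers (JW TW isSymm_TW isUnit_det_TW JW_eq JW_apply_ne_zero locF lineOf Rep
  Eps Chi epsOf omegaAtLine rhoAtLine rhoVAtLine lineChar)
open Literature.NumberTheory.GelbartRogawski1991 Literature.NumberTheory.GelbartRogawski1991.UnitaryDualPair
open Literature.NumberTheory.Weil1964 Literature.RepresentationTheory
open Literature.RepresentationTheory.Liu2021
open Summit.HodgeConjecture.CorCM.Transposition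
open Summit.HodgeConjecture.CorCM.Transposition.OmegaTransport

section Sigma

set_option maxHeartbeats 1000000 in
/-- **`σ` — THE ADMISSIBLE INDEX `(ε, χ ∘ centre)` OF [Liu2021, Thm. 4.18]'s DIRECT SUM at the Liu datum `restOfCharRep … δ′ r μ hμ hw`**, for a
collection `ε` represented by `r` (`locF (r ε) = ε`, i.e. `ε` global), a character `χ` of `U(J_W′)(𝔸_f)`, `J_W′ = (r ε)`, with open kernel and
trivial rational restriction, at a normaliser `δ′` anti-oriented to `δ_F` and `Φ_μ` δ-positive at `r ε` (the line of record's `Φ^δ`):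
Def. 4.12's witness is `e₀ := (r ε)·δ′` (`isAdmissibleElement_mul_of_antiOriented`, `epsOf_algebraMap_mul`, `r.locF_toFun`).
[cite: Liu2021, Def. 4.11 (FJcycle.tex l. 2088–2090), Def. 4.12 (l. 2102–2108), Thm. 4.18 (l. 2232–2237)] -/
def admIndexAtLine (h : exists_recordSystem) (F : CMField) [IsGalois ℚ F] (h6 : 6 ≤ Module.finrank ℚ F)
    (ι₁ : F →+* ℂ) (V : HermSpace3 F ι₁) (Φ : CMType F) {n : ℕ} (e : Fin 3 × Fin 1 ≃ Fin n) (dV : Fin 3 → F)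
    (hdV : ∀ i, IsCMField.complexConj F (dV i) = dV i) (hdV0 : ∀ i, dV i ≠ 0)
    (ιV : (sec42DataOf h isoOf F ι₁ V Φ).G →*
      UnitaryGroup.finAdelic ↥(maximalRealSubfield F) F (IsCMField.complexConj F) 3 (Matrix.diagonal dV))
    (δ' : F) (hcδ' : IsCMField.complexConj F δ' = -δ') (hδ'0 : δ' ≠ 0)
    (hδ' : ∀ τ : F →+* ℂ, (τ δ').im * (τ (imagUnit F)).im < 0)
    (r : Rep ↥(maximalRealSubfield F) (imagUnitSq F))
    (μ : IdeleClassGroup F →ₜ* Circle) (hμ : IdeleClassGroup.IsConjugateSymplectic F μ) (hw : IdeleClassGroup.HasWeight F μ 1)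
    (ε : Eps ↥(maximalRealSubfield F) (imagUnitSq F)) (hε : ∃ a, locF ↥(maximalRealSubfield F) (imagUnitSq F) a = ε)
    (hΦ : ∀ τ : F →+* ℂ, τ ∈ hμ.cmType.1 → 0 < (τ (imagUnit F * algebraMap ↥(maximalRealSubfield F) F (r.toFun ε))).im)
    (JW' : Matrix (Fin 1) (Fin 1) F) (hJ : JW ↥(maximalRealSubfield F) F (r.toFun ε) = JW')
    (χ : {χ : ↥(UnitaryGroup.finAdelic ↥(maximalRealSubfield F) F (IsCMField.complexConj F) 1 JW') →* ℂˣ //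
      IsOpen ((χ.ker : Subgroup _) : Set ↥(UnitaryGroup.finAdelic ↥(maximalRealSubfield F) F (IsCMField.complexConj F) 1 JW')) ∧
        ∀ γ : UnitaryGroup.rational ↥(maximalRealSubfield F) F (IsCMField.complexConj F) 1 JW',
          χ (UnitaryGroup.rationalToFinAdelic ↥(maximalRealSubfield F) F (IsCMField.complexConj F) 1 JW' γ) = 1}) :
    (toThm418Data (sec42DataOf h isoOf F ι₁ V Φ) (restOfCharRep h F h6 ι₁ V Φ e dV hdV hdV0 ιV δ' r μ hμ hw)).AdmIndex :=
  ⟨(ε, chiAtLine F (r.toFun ε) JW' hJ χ.1 χ.2.1 χ.2.2),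
    ⟨algebraMap ↥(maximalRealSubfield F) F (r.toFun ε) * δ',
      isAdmissibleElement_mul_of_antiOriented F _ (r.toFun ε) δ' hcδ' hδ'0 hδ' hΦ,
      (Def411WeilCarriers.epsOf_algebraMap_mul ↥(maximalRealSubfield F) (imagUnitSq F) F δ' hδ'0 (r.toFun ε)).trans (r.locF_toFun ε hε)⟩⟩

/-- the `Eps`-component of `σ χ` is `ε`. [cite: Liu2021, Thm. 4.18 (FJcycle.tex l. 2232–2237)] -/
theorem admIndexAtLine_fst (h : exists_recordSystem) (F : CMField) [IsGalois ℚ F] (h6 : 6 ≤ Module.finrank ℚ F)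
    (ι₁ : F →+* ℂ) (V : HermSpace3 F ι₁) (Φ : CMType F) {n : ℕ} (e : Fin 3 × Fin 1 ≃ Fin n) (dV : Fin 3 → F)
    (hdV : ∀ i, IsCMField.complexConj F (dV i) = dV i) (hdV0 : ∀ i, dV i ≠ 0)
    (ιV : (sec42DataOf h isoOf F ι₁ V Φ).G →*
      UnitaryGroup.finAdelic ↥(maximalRealSubfield F) F (IsCMField.complexConj F) 3 (Matrix.diagonal dV))
    (δ' : F) (hcδ' : IsCMField.complexConj F δ' = -δ') (hδ'0 : δ' ≠ 0)
    (hδ' : ∀ τ : F →+* ℂ, (τ δ').im * (τ (imagUnit F)).im < 0)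
    (r : Rep ↥(maximalRealSubfield F) (imagUnitSq F))
    (μ : IdeleClassGroup F →ₜ* Circle) (hμ : IdeleClassGroup.IsConjugateSymplectic F μ) (hw : IdeleClassGroup.HasWeight F μ 1)
    (ε : Eps ↥(maximalRealSubfield F) (imagUnitSq F)) (hε : ∃ a, locF ↥(maximalRealSubfield F) (imagUnitSq F) a = ε)
    (hΦ : ∀ τ : F →+* ℂ, τ ∈ hμ.cmType.1 → 0 < (τ (imagUnit F * algebraMap ↥(maximalRealSubfield F) F (r.toFun ε))).im)
    (JW' : Matrix (Fin 1) (Fin 1) F) (hJ : JW ↥(maximalRealSubfield F) F (r.toFun ε) = JW')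
    (χ : {χ : ↥(UnitaryGroup.finAdelic ↥(maximalRealSubfield F) F (IsCMField.complexConj F) 1 JW') →* ℂˣ //
      IsOpen ((χ.ker : Subgroup _) : Set ↥(UnitaryGroup.finAdelic ↥(maximalRealSubfield F) F (IsCMField.complexConj F) 1 JW')) ∧
        ∀ γ : UnitaryGroup.rational ↥(maximalRealSubfield F) F (IsCMField.complexConj F) 1 JW',
          χ (UnitaryGroup.rationalToFinAdelic ↥(maximalRealSubfield F) F (IsCMField.complexConj F) 1 JW' γ) = 1}) :
    (admIndexAtLine h F h6 ι₁ V Φ e dV hdV hdV0 ιV δ' hcδ' hδ'0 hδ' r μ hμ hw ε hε hΦ JW' hJ χ).1.1 = ε :=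
  rfl

/-- **`hσ` — `σ` is injective in `χ`.** [cite: Liu2021, Thm. 4.18 (FJcycle.tex l. 2232–2237)] -/
theorem admIndexAtLine_injective (h : exists_recordSystem) (F : CMField) [IsGalois ℚ F] (h6 : 6 ≤ Module.finrank ℚ F)
    (ι₁ : F →+* ℂ) (V : HermSpace3 F ι₁) (Φ : CMType F) {n : ℕ} (e : Fin 3 × Fin 1 ≃ Fin n) (dV : Fin 3 → F)
    (hdV : ∀ i, IsCMField.complexConj F (dV i) = dV i) (hdV0 : ∀ i, dV i ≠ 0)
    (ιV : (sec42DataOf h isoOf F ι₁ V Φ).G →*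
      UnitaryGroup.finAdelic ↥(maximalRealSubfield F) F (IsCMField.complexConj F) 3 (Matrix.diagonal dV))
    (δ' : F) (hcδ' : IsCMField.complexConj F δ' = -δ') (hδ'0 : δ' ≠ 0)
    (hδ' : ∀ τ : F →+* ℂ, (τ δ').im * (τ (imagUnit F)).im < 0)
    (r : Rep ↥(maximalRealSubfield F) (imagUnitSq F))
    (μ : IdeleClassGroup F →ₜ* Circle) (hμ : IdeleClassGroup.IsConjugateSymplectic F μ) (hw : IdeleClassGroup.HasWeight F μ 1)
    (ε : Eps ↥(maximalRealSubfield F) (imagUnitSq F)) (hε : ∃ a, locF ↥(maximalRealSubfield F) (imagUnitSq F) a = ε)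
    (hΦ : ∀ τ : F →+* ℂ, τ ∈ hμ.cmType.1 → 0 < (τ (imagUnit F * algebraMap ↥(maximalRealSubfield F) F (r.toFun ε))).im)
    (JW' : Matrix (Fin 1) (Fin 1) F) (hJ : JW ↥(maximalRealSubfield F) F (r.toFun ε) = JW') :
    Function.Injective (admIndexAtLine h F h6 ι₁ V Φ e dV hdV hdV0 ιV δ' hcδ' hδ'0 hδ' r μ hμ hw ε hε hΦ JW' hJ) := by
  intro χ₁ χ₂ hχ
  have h2 : chiAtLine F (r.toFun ε) JW' hJ χ₁.1 χ₁.2.1 χ₁.2.2 = chiAtLine F (r.toFun ε) JW' hJ χ₂.1 χ₂.2.1 χ₂.2.2 :=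
    (Prod.ext_iff.1 (congrArg Subtype.val hχ)).2
  exact Subtype.ext (chiAtLine_injective F (r.toFun ε) JW' hJ χ₁.2.1 χ₁.2.2 χ₂.2.1 χ₂.2.2 h2)

end Sigma

section TransportHelpers

/-- the port's and the Literature's relation submodules of the `χ`-coinvariants are THE SAME submodule (twin definitions), for equal
characters. [folklore] -/
private theorem ker_twin_eq {k : Type*} [CommRing k] {H S : Type*} [Group H] [AddCommGroup S] [Module k S]
    (ρW : Representation k H S) {χ ψ : H →* kˣ} (hψ : ψ = χ) :
    HodgeCM.TwistedCoinv.ker ρW χ = Literature.RepresentationTheory.TwistedCoinv.ker ρW ψ := by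
  subst hψ
  rfl

/-- on `ρ.asModule` the group-ring generator `of g` acts by `ρ g` (`Representation.asModuleEquiv_symm_map_rho`, the identification
`asModuleEquiv` being the identity). [folklore] -/
private theorem of_smul_eq_asModule {k G W : Type*} [CommSemiring k] [Monoid G] [AddCommMonoid W] [Module k W]
    (ρ : Representation k G W) (g : G) (x : ρ.asModule) :
    MonoidAlgebra.of k G g • x = ρ.asModuleEquiv.symm (ρ g (ρ.asModuleEquiv x)) := by
  rw [Representation.asModuleEquiv_symm_map_rho, LinearEquiv.symm_apply_apply]

end TransportHelpers

section Transport

set_option maxHeartbeats 2000000 in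
-- (the two `subst`s and the definitional comparison of the twin `finPairRepW`s run over the `splittingDatum` telescope)
/-- **`e` — THE X3-ω TRANSPORT at the line of record**: the package's Weil `χ`-coinvariant module of the finite-adelic dual pair
`U(diag dV) × U(J_W′)` at the splitting `ι_{toHecke μ}` transported to `(T_W′, J_W′)` (`chiSplittingLine …`, [GR91] Prop. 3.1.1 ∕ [Liu2021] App. D
Step 2), pulled back along `ιV` — LITERALLY the carrier `Representation.asModule ((HodgeCM.WeilCoinv.weilCoinv …).comp ιV)` of
`SplitLine.Ω (ofCM …) ιV χ` — IS, as a `ℂ`-module, `ω(μ, ε, χ ∘ centre) = (toThm418Data … (restOfCharRep … δ′ r μ hμ hw)).omegaAt (σ χ)` whenever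
`(T_W′, J_W′) = (T_W (r ε), J_W (r ε))`: both are quotients of `𝒮((𝔸_{F⁺}^∞)^{3·1})` by THE SAME relation submodule (`Submodule.quotEquivOfEq`; the
port's and the Literature's `finPairRepW ∕ TwistedCoinv.ker` agree by `rfl`, the characters by `lineChar_chiAtLine_self`).
[cite: Liu2021, Def. 4.11 (FJcycle.tex l. 2092–2096), App. D §D.1 Steps 1–3 (l. 5215–5221), Thm. 4.18 (l. 2232–2237)]
[cite: GelbartRogawski1991, §3.1 Prop. 3.1.1 p. 455 L1–3] -/
def omegaTransportAtLine (h : exists_recordSystem) (F : CMField) [IsGalois ℚ F] (h6 : 6 ≤ Module.finrank ℚ F)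
    (ι₁ : F →+* ℂ) (V : HermSpace3 F ι₁) (Φ : CMType F) {n : ℕ} (e : Fin 3 × Fin 1 ≃ Fin n) (dV : Fin 3 → F)
    (hdV : ∀ i, IsCMField.complexConj F (dV i) = dV i) (hdV0 : ∀ i, dV i ≠ 0)
    (ιV : (sec42DataOf h isoOf F ι₁ V Φ).G →*
      UnitaryGroup.finAdelic ↥(maximalRealSubfield F) F (IsCMField.complexConj F) 3 (Matrix.diagonal dV))
    (δ' : F) (hcδ' : IsCMField.complexConj F δ' = -δ') (hδ'0 : δ' ≠ 0)
    (hδ' : ∀ τ : F →+* ℂ, (τ δ').im * (τ (imagUnit F)).im < 0)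
    (r : Rep ↥(maximalRealSubfield F) (imagUnitSq F))
    (μ : IdeleClassGroup F →ₜ* Circle) (hμ : IdeleClassGroup.IsConjugateSymplectic F μ) (hw : IdeleClassGroup.HasWeight F μ 1)
    (ε : Eps ↥(maximalRealSubfield F) (imagUnitSq F)) (hε : ∃ a, locF ↥(maximalRealSubfield F) (imagUnitSq F) a = ε)
    (hΦ : ∀ τ : F →+* ℂ, τ ∈ hμ.cmType.1 → 0 < (τ (imagUnit F * algebraMap ↥(maximalRealSubfield F) F (r.toFun ε))).im)
    (TW' : Matrix (Fin 1) (Fin 1) ↥(maximalRealSubfield F)) (JW' : Matrix (Fin 1) (Fin 1) F)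
    (hW' : TW'.IsSymm) (hWd' : IsUnit TW'.det) (hJW' : JW' = TW'.map (algebraMap ↥(maximalRealSubfield F) F))
    (hT : TW ↥(maximalRealSubfield F) (r.toFun ε) = TW') (hJ : JW ↥(maximalRealSubfield F) F (r.toFun ε) = JW')
    (hs' : (splittingDatum ↥(maximalRealSubfield F) F (IsCMField.complexConj F) 3 1 e (Matrix.diagonal dV) JW'
        (complexConj_imagUnit F) (imagUnit_ne_zero F) (imagUnit_mul_self F) (realDiagonal_isSymm F dV hdV) hW'
        (isUnit_det_realDiagonal F dV hdV hdV0) hWd' (realDiagonal_map F dV hdV).symm hJW').IsCompatible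
      (Def411WeilCarriersDoubling.chiSplittingLine F e dV hdV hdV0 (toHeckeCharacter F μ) (isUnitary_toHeckeCharacter F μ)
        ((isOscillatorChar_toHeckeCharacter_iff μ).mpr hμ) TW' hWd' JW' hJW'))
    (χ : {χ : ↥(UnitaryGroup.finAdelic ↥(maximalRealSubfield F) F (IsCMField.complexConj F) 1 JW') →* ℂˣ //
      IsOpen ((χ.ker : Subgroup _) : Set ↥(UnitaryGroup.finAdelic ↥(maximalRealSubfield F) F (IsCMField.complexConj F) 1 JW')) ∧
        ∀ γ : UnitaryGroup.rational ↥(maximalRealSubfield F) F (IsCMField.complexConj F) 1 JW',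
          χ (UnitaryGroup.rationalToFinAdelic ↥(maximalRealSubfield F) F (IsCMField.complexConj F) 1 JW' γ) = 1}) :
    Representation.asModule
        ((HodgeCM.WeilCoinv.weilCoinv ↥(maximalRealSubfield F) F (IsCMField.complexConj F) 3 1 e (Matrix.diagonal dV) JW'
          (complexConj_imagUnit F) (imagUnit_ne_zero F) (imagUnit_mul_self F) (realDiagonal_isSymm F dV hdV) hW'
          (isUnit_det_realDiagonal F dV hdV hdV0) hWd' (realDiagonal_map F dV hdV).symm hJW' χ.1 hs').comp ιV) ≃ₗ[ℂ]
      (toThm418Data (sec42DataOf h isoOf F ι₁ V Φ) (restOfCharRep h F h6 ι₁ V Φ e dV hdV hdV0 ιV δ' r μ hμ hw)).omegaAt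
        (admIndexAtLine h F h6 ι₁ V Φ e dV hdV hdV0 ιV δ' hcδ' hδ'0 hδ' r μ hμ hw ε hε hΦ JW' hJ χ) := by
  subst hJ
  subst hT
  refine Submodule.quotEquivOfEq _ _ ?_
  -- the two relation submodules of `𝒮((𝔸^∞)^{3·1})`: same finite Weil representation (twin constructions, `rfl`), same character
  exact ker_twin_eq _ (lineChar_chiAtLine_self F (r.toFun ε) χ.1 χ.2.1 χ.2.2)

set_option maxHeartbeats 2000000 in
/-- `e` on generators: the class of `f ∈ 𝒮` goes to the class of `f`. [cite: Liu2021, App. D §D.1 Step 3 (FJcycle.tex l. 5221)] -/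
theorem omegaTransportAtLine_mk (h : exists_recordSystem) (F : CMField) [IsGalois ℚ F] (h6 : 6 ≤ Module.finrank ℚ F)
    (ι₁ : F →+* ℂ) (V : HermSpace3 F ι₁) (Φ : CMType F) {n : ℕ} (e : Fin 3 × Fin 1 ≃ Fin n) (dV : Fin 3 → F)
    (hdV : ∀ i, IsCMField.complexConj F (dV i) = dV i) (hdV0 : ∀ i, dV i ≠ 0)
    (ιV : (sec42DataOf h isoOf F ι₁ V Φ).G →*
      UnitaryGroup.finAdelic ↥(maximalRealSubfield F) F (IsCMField.complexConj F) 3 (Matrix.diagonal dV))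
    (δ' : F) (hcδ' : IsCMField.complexConj F δ' = -δ') (hδ'0 : δ' ≠ 0)
    (hδ' : ∀ τ : F →+* ℂ, (τ δ').im * (τ (imagUnit F)).im < 0)
    (r : Rep ↥(maximalRealSubfield F) (imagUnitSq F))
    (μ : IdeleClassGroup F →ₜ* Circle) (hμ : IdeleClassGroup.IsConjugateSymplectic F μ) (hw : IdeleClassGroup.HasWeight F μ 1)
    (ε : Eps ↥(maximalRealSubfield F) (imagUnitSq F)) (hε : ∃ a, locF ↥(maximalRealSubfield F) (imagUnitSq F) a = ε)
    (hΦ : ∀ τ : F →+* ℂ, τ ∈ hμ.cmType.1 → 0 < (τ (imagUnit F * algebraMap ↥(maximalRealSubfield F) F (r.toFun ε))).im)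
    (TW' : Matrix (Fin 1) (Fin 1) ↥(maximalRealSubfield F)) (JW' : Matrix (Fin 1) (Fin 1) F)
    (hW' : TW'.IsSymm) (hWd' : IsUnit TW'.det) (hJW' : JW' = TW'.map (algebraMap ↥(maximalRealSubfield F) F))
    (hT : TW ↥(maximalRealSubfield F) (r.toFun ε) = TW') (hJ : JW ↥(maximalRealSubfield F) F (r.toFun ε) = JW')
    (hs' : (splittingDatum ↥(maximalRealSubfield F) F (IsCMField.complexConj F) 3 1 e (Matrix.diagonal dV) JW'
        (complexConj_imagUnit F) (imagUnit_ne_zero F) (imagUnit_mul_self F) (realDiagonal_isSymm F dV hdV) hW'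
        (isUnit_det_realDiagonal F dV hdV hdV0) hWd' (realDiagonal_map F dV hdV).symm hJW').IsCompatible
      (Def411WeilCarriersDoubling.chiSplittingLine F e dV hdV hdV0 (toHeckeCharacter F μ) (isUnitary_toHeckeCharacter F μ)
        ((isOscillatorChar_toHeckeCharacter_iff μ).mpr hμ) TW' hWd' JW' hJW'))
    (χ : {χ : ↥(UnitaryGroup.finAdelic ↥(maximalRealSubfield F) F (IsCMField.complexConj F) 1 JW') →* ℂˣ //
      IsOpen ((χ.ker : Subgroup _) : Set ↥(UnitaryGroup.finAdelic ↥(maximalRealSubfield F) F (IsCMField.complexConj F) 1 JW')) ∧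
        ∀ γ : UnitaryGroup.rational ↥(maximalRealSubfield F) F (IsCMField.complexConj F) 1 JW',
          χ (UnitaryGroup.rationalToFinAdelic ↥(maximalRealSubfield F) F (IsCMField.complexConj F) 1 JW' γ) = 1})
    (f : FinSB ↥(maximalRealSubfield F) (Fin 3 × Fin 1)) :
    omegaTransportAtLine h F h6 ι₁ V Φ e dV hdV hdV0 ιV δ' hcδ' hδ'0 hδ' r μ hμ hw ε hε hΦ TW' JW' hW' hWd' hJW' hT hJ hs' χ
        (Submodule.Quotient.mk f) = Submodule.Quotient.mk f := by
  subst hJ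
  subst hT
  rfl

set_option maxHeartbeats 2000000 in
/-- **`he` — `e` is `𝔾(𝔸^∞)`-equivariant**: `e (g • m) = ρ(μ, ε, χ ∘ centre)(g) (e m)` for the `ℂ[U(V)(𝔸_f)]`-module structure of the package
carrier (`Representation.asModule`) and the action `rhoAt (σ χ)` of the Liu datum — both act on the class of `f` by the class of
`ω_f(s_pair(ιV g, 1)) f` (`weilCoinv_mk` on either side). [cite: Liu2021, Def. 4.11 (FJcycle.tex l. 2092–2096), App. D §D.1 Step 3 (l. 5221)] -/
theorem omegaTransportAtLine_smul (h : exists_recordSystem) (F : CMField) [IsGalois ℚ F] (h6 : 6 ≤ Module.finrank ℚ F)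
    (ι₁ : F →+* ℂ) (V : HermSpace3 F ι₁) (Φ : CMType F) {n : ℕ} (e : Fin 3 × Fin 1 ≃ Fin n) (dV : Fin 3 → F)
    (hdV : ∀ i, IsCMField.complexConj F (dV i) = dV i) (hdV0 : ∀ i, dV i ≠ 0)
    (ιV : (sec42DataOf h isoOf F ι₁ V Φ).G →*
      UnitaryGroup.finAdelic ↥(maximalRealSubfield F) F (IsCMField.complexConj F) 3 (Matrix.diagonal dV))
    (δ' : F) (hcδ' : IsCMField.complexConj F δ' = -δ') (hδ'0 : δ' ≠ 0)
    (hδ' : ∀ τ : F →+* ℂ, (τ δ').im * (τ (imagUnit F)).im < 0)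
    (r : Rep ↥(maximalRealSubfield F) (imagUnitSq F))
    (μ : IdeleClassGroup F →ₜ* Circle) (hμ : IdeleClassGroup.IsConjugateSymplectic F μ) (hw : IdeleClassGroup.HasWeight F μ 1)
    (ε : Eps ↥(maximalRealSubfield F) (imagUnitSq F)) (hε : ∃ a, locF ↥(maximalRealSubfield F) (imagUnitSq F) a = ε)
    (hΦ : ∀ τ : F →+* ℂ, τ ∈ hμ.cmType.1 → 0 < (τ (imagUnit F * algebraMap ↥(maximalRealSubfield F) F (r.toFun ε))).im)
    (TW' : Matrix (Fin 1) (Fin 1) ↥(maximalRealSubfield F)) (JW' : Matrix (Fin 1) (Fin 1) F)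
    (hW' : TW'.IsSymm) (hWd' : IsUnit TW'.det) (hJW' : JW' = TW'.map (algebraMap ↥(maximalRealSubfield F) F))
    (hT : TW ↥(maximalRealSubfield F) (r.toFun ε) = TW') (hJ : JW ↥(maximalRealSubfield F) F (r.toFun ε) = JW')
    (hs' : (splittingDatum ↥(maximalRealSubfield F) F (IsCMField.complexConj F) 3 1 e (Matrix.diagonal dV) JW'
        (complexConj_imagUnit F) (imagUnit_ne_zero F) (imagUnit_mul_self F) (realDiagonal_isSymm F dV hdV) hW'
        (isUnit_det_realDiagonal F dV hdV hdV0) hWd' (realDiagonal_map F dV hdV).symm hJW').IsCompatible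
      (Def411WeilCarriersDoubling.chiSplittingLine F e dV hdV hdV0 (toHeckeCharacter F μ) (isUnitary_toHeckeCharacter F μ)
        ((isOscillatorChar_toHeckeCharacter_iff μ).mpr hμ) TW' hWd' JW' hJW'))
    (χ : {χ : ↥(UnitaryGroup.finAdelic ↥(maximalRealSubfield F) F (IsCMField.complexConj F) 1 JW') →* ℂˣ //
      IsOpen ((χ.ker : Subgroup _) : Set ↥(UnitaryGroup.finAdelic ↥(maximalRealSubfield F) F (IsCMField.complexConj F) 1 JW')) ∧
        ∀ γ : UnitaryGroup.rational ↥(maximalRealSubfield F) F (IsCMField.complexConj F) 1 JW',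
          χ (UnitaryGroup.rationalToFinAdelic ↥(maximalRealSubfield F) F (IsCMField.complexConj F) 1 JW' γ) = 1})
    (g : (sec42DataOf h isoOf F ι₁ V Φ).G)
    (m : Representation.asModule
        ((HodgeCM.WeilCoinv.weilCoinv ↥(maximalRealSubfield F) F (IsCMField.complexConj F) 3 1 e (Matrix.diagonal dV) JW'
          (complexConj_imagUnit F) (imagUnit_ne_zero F) (imagUnit_mul_self F) (realDiagonal_isSymm F dV hdV) hW'
          (isUnit_det_realDiagonal F dV hdV hdV0) hWd' (realDiagonal_map F dV hdV).symm hJW' χ.1 hs').comp ιV)) :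
    omegaTransportAtLine h F h6 ι₁ V Φ e dV hdV hdV0 ιV δ' hcδ' hδ'0 hδ' r μ hμ hw ε hε hΦ TW' JW' hW' hWd' hJW' hT hJ hs' χ
        (MonoidAlgebra.of ℂ (sec42DataOf h isoOf F ι₁ V Φ).G g • m) =
      (toThm418Data (sec42DataOf h isoOf F ι₁ V Φ) (restOfCharRep h F h6 ι₁ V Φ e dV hdV hdV0 ιV δ' r μ hμ hw)).rhoAt
        (admIndexAtLine h F h6 ι₁ V Φ e dV hdV hdV0 ιV δ' hcδ' hδ'0 hδ' r μ hμ hw ε hε hΦ JW' hJ χ) g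
        (omegaTransportAtLine h F h6 ι₁ V Φ e dV hdV hdV0 ιV δ' hcδ' hδ'0 hδ' r μ hμ hw ε hε hΦ TW' JW' hW' hWd' hJW' hT hJ hs' χ m) := by
  subst hJ
  subst hT
  -- the `ℂ[G]`-scalar `of g` acts on the package carrier through the representation
  rw [of_smul_eq_asModule]
  obtain ⟨f, rfl⟩ := Submodule.Quotient.mk_surjective _ m
  rfl

end Transport

end Summit.HodgeConjecture.CorCM.Model

end
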